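/-
Copyright: the b2b-balaban T⁴-continuum CRUX team, row NE7b OWNER lineage `t4-ne7b-p1` (gen 131). Project licence.
-/
import Literature.Probability.Distributions.GaussianInterpolationFormula
import Literature.NumberTheory.Automorphic.ArchimedeanDetIntegral

/-!
# THE TILTED STEIN IDENTITY — LINEAR OBSERVABLES REDUCE TO ONE-SITE OBSERVABLES: for the step `ν ∝ e^{−V}dN(0,Γ)`,
# `V(ω) = Σ_{x∈Y} w_x(ω_x + ψ_x)` with NONNEGATIVE `C¹` remainders (`0 ≤ w`, `|w′| ≤ κ₁|u|`) and a one-site `C¹` observable `F` of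
# polynomial growth at the site `z`, Gaussian integration by parts (the tree's multivariate Stein identity) gives
#   `∫ ω_y·e^{−V}F(u_z) dN(0,Γ) = Γ_{yz}·∫ e^{−V}F′(u_z) dN(0,Γ) − Σ_{x∈Y} Γ_{yx}·∫ e^{−V}F(u_z)w′_x(u_x) dN(0,Γ)`
# (`u_x = ω_x + ψ_x`), i.e. after dividing by `Z`: `E_ν[ω_yF_z] = Γ_{yz}E_ν[F′_z] − Σ_{x∈Y}Γ_{yx}E_ν[F_zw′_x]` and
# `Cov_ν(ω_y, F_z) = Γ_{yz}E_ν[F′_z] − Σ_{x∈Y}Γ_{yx}Cov_ν(w′_x, F_z)` — the LINEAR observable `ω_y` is traded for the finite-range row `Γ_{y·}`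
# against ONE-SITE observables `w′_x`, whose tilted covariances decay by (332c): SCOPING-d4's located item (b) («linear ∕ multi-site
# observables are NOT covered») for the nonnegative class (row NE7b, node U5c; the tree's `GaussianInterpolation.integral_eval_mul_eq_sum`
# BY NAME; [folklore])

Cell `pub-balaban`, sub-cell `t4`, spine estimate NE7b (`T4WeightBudget.RelWeightBound`; the cell's OWN estimate — NOT PRINTED in
[Bałaban 1983–89], NOT PROVED).  Crux-route work under `Spine/NE7b/` by the row OWNER (`t4-ne7b-p1` gen 131, file (345)) under FREEZE
(0)'s crux-prover clause, on § [NE7bP1-G130-HANDOFF] NEXT (3)(b) («the TRANSLATION family for linear ∕ multi-site observables»); NOTHING of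
Bałaban's is named as a Lean object, valued or asserted; no `T4Continuum/Support` leaf typed; no `def`, no notation; zero `sorry`.  Imports
(BY NAME): the tree's `Literature/Probability/Distributions/GaussianInterpolationFormula` (`integral_eval_mul_eq_sum` — GJ (9.1.28) ∕
Contucci–Giardinà (1.19) in finite dimensions, for `C¹` observables of polynomial growth); Mathlib's `IsGaussian.memLp_id` (Fernique),
`PiLp.norm_apply_le`, `ContinuousLinearMap.opNorm_le_bound`; the tree's elementary `one_add_pow_le_two_pow_mul`
(`Literature/NumberTheory/Automorphic/ArchimedeanDetIntegral`, reused per the gate's dedup rule).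

WHAT IS PROVED ([folklore]):
* §1 growth & integrability: `integrable_of_poly_growth` (polynomial growth ⟹ integrable against `N(0,Γ)`),
  `abs_apply_le_norm`, `one_add_abs_site_le`, `sum_abs_site_le`;
* §2 calculus of `G(ω) = e^{−V(ω)}F(u_z)`: `hasFDerivAt_V`, `hasFDerivAt_G`, `fderiv_G_single` (`DG(ω)e_b = e^{−V}(F′(u_z)1_{z=b} − F(u_z)w′_b(u_b)1_{b∈Y})`),
  `contDiff_G`; §3 growth of `G` and `DG`: `abs_G_le`, `norm_fderiv_G_le` (both `≤ K(1+‖ω‖)^{m+1}`);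
* §4 THE END **`tilted_stein`** (the displayed identity of unnormalised expectations) and **`tilted_stein_mean`** (`F ≡ 1`:
  `∫ ω_y e^{−V} dN(0,Γ) = −Σ_{x∈Y}Γ_{yx}∫ e^{−V}w′_x(u_x) dN(0,Γ)`); §5 toy.

HONEST (what this is NOT).  The NONNEGATIVE class only (`0 ≤ w`, so `e^{−V} ≤ 1` and the tree's polynomial-growth Stein identity applies
verbatim; the stable class `−κ₀u² ≤ w` needs the quadratic tilt absorbed into the Gaussian first — (288)'s pattern, the successor's); the
covariance-DECAY corollary for linear observables (this identity ⊛ (332c) ⊛ finite range of `Γ`) is the successor's one-file use; scalar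
skeleton ((A3), NC-NE7b-α UNRULED); nothing of Bałaban's asserted.  BY-NAME EFFECT ON THE WALL: NONE.  NE7b NOT PRINTED ∕ NOT PROVED; spine
PROVED 0∕9; rung (B)+1 — the programme's measures remain FINITE-torus statements; NOT the mass gap, NOT Clay.  HONEST DEPENDENCY: continuum
YM on T⁴ ⇐ BetaPertH ∧ nine spine estimates (0∕9 proved); BetaPertH ⇐ (D1) ∧ (D4) ∧ CAP+tail; G-an2-4 gates asym, D1 and NE2∕3∕4.
-/

set_option autoImplicit false

noncomputable section

namespace Summit.QuantumFields.BalabanUV.T4Continuum.NE7b.SupTiltedSteinIdentity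

open MeasureTheory ProbabilityTheory Finset Real
open scoped BigOperators
open Literature.Probability.Distributions.GaussianInterpolation (integral_eval_mul_eq_sum)
open Literature.NumberTheory.Automorphic (one_add_pow_le_two_pow_mul)

variable {ι : Type} [Fintype ι] [DecidableEq ι]

/-! ## §1. Polynomial growth and Gaussian integrability -/

/-- **Polynomial growth ⟹ integrable against `N(0,Γ)`** (all moments of a Gaussian measure are finite — Mathlib's `IsGaussian.memLp_id`;
adapted from the tree's private `GaussianInterpolation.integrable_of_norm_le_poly`). [folklore] -/
theorem integrable_of_poly_growth (Γ : Matrix ι ι ℝ) {f : EuclideanSpace ℝ ι → ℝ}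
    (hf : AEStronglyMeasurable f (multivariateGaussian 0 Γ)) {K : ℝ} {N : ℕ} (h : ∀ x, ‖f x‖ ≤ K * (1 + ‖x‖) ^ N) :
    Integrable f (multivariateGaussian 0 Γ) := by
  have hK : 0 ≤ K := by
    have h0 := h 0
    have hp : (0 : ℝ) < (1 + ‖(0 : EuclideanSpace ℝ ι)‖) ^ N := by positivity
    nlinarith [norm_nonneg (f 0)]
  have hpow : Integrable (fun x : EuclideanSpace ℝ ι => ‖x‖ ^ N) (multivariateGaussian 0 Γ) := by
    rcases Nat.eq_zero_or_pos N with hN | hN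
    · subst hN; simp
    · simpa using (IsGaussian.memLp_id (multivariateGaussian 0 Γ) N (by simp)).integrable_norm_pow hN.ne'
  have hbound : Integrable (fun x : EuclideanSpace ℝ ι => K * (2 ^ N * (1 + ‖x‖ ^ N))) (multivariateGaussian 0 Γ) :=
    (((integrable_const (1 : ℝ)).add hpow).const_mul (2 ^ N)).const_mul K
  refine hbound.mono' hf (ae_of_all _ fun x => (h x).trans ?_)
  exact mul_le_mul_of_nonneg_left (one_add_pow_le_two_pow_mul ‖x‖ (norm_nonneg x) N) hK

omit [DecidableEq ι] in
/-- `|ω_x| ≤ ‖ω‖`. [folklore] -/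
theorem abs_apply_le_norm (ω : EuclideanSpace ℝ ι) (x : ι) : |ω x| ≤ ‖ω‖ := by
  have h := PiLp.norm_apply_le ω x
  rwa [Real.norm_eq_abs] at h

omit [DecidableEq ι] in
/-- `1 + |ω_x + c| ≤ (1 + |c|)(1 + ‖ω‖)`. [folklore] -/
theorem one_add_abs_site_le (ω : EuclideanSpace ℝ ι) (c : ℝ) (x : ι) : 1 + |ω x + c| ≤ (1 + |c|) * (1 + ‖ω‖) := by
  have h1 := abs_apply_le_norm ω x
  have h2 := abs_add_le (ω x) c
  nlinarith [abs_nonneg c, norm_nonneg ω]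

omit [DecidableEq ι] in
/-- `Σ_{x∈Y}|ω_x + ψ_x| ≤ (#Y + Σ_{x∈Y}|ψ_x|)(1 + ‖ω‖)`. [folklore] -/
theorem sum_abs_site_le (Y : Finset ι) (ω : EuclideanSpace ℝ ι) (ψ : ι → ℝ) :
    ∑ x ∈ Y, |ω x + ψ x| ≤ ((Y.card : ℝ) + ∑ x ∈ Y, |ψ x|) * (1 + ‖ω‖) := by
  have hpt : ∀ x ∈ Y, |ω x + ψ x| ≤ ‖ω‖ + |ψ x| := fun x _ => (abs_add_le _ _).trans (by linarith [abs_apply_le_norm ω x])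
  calc ∑ x ∈ Y, |ω x + ψ x| ≤ ∑ x ∈ Y, (‖ω‖ + |ψ x|) := sum_le_sum hpt
    _ = (Y.card : ℝ) * ‖ω‖ + ∑ x ∈ Y, |ψ x| := by rw [sum_add_distrib, sum_const, nsmul_eq_mul]
    _ ≤ ((Y.card : ℝ) + ∑ x ∈ Y, |ψ x|) * (1 + ‖ω‖) := by
        have h0 : 0 ≤ ∑ x ∈ Y, |ψ x| := sum_nonneg fun x _ => abs_nonneg _
        nlinarith [norm_nonneg ω]

/-! ## §2. Calculus of `G(ω) = e^{−V(ω)}F(u_z)` -/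

section Calculus

variable (Y : Finset ι) {w w' : ι → ℝ → ℝ} {F F' : ℝ → ℝ} (ψ : ι → ℝ) (z : ι)

omit [DecidableEq ι] in
/-- `D_ω V = Σ_{x∈Y} w′_x(u_x)•proj_x`. [folklore] -/
theorem hasFDerivAt_V (hw' : ∀ x t, HasDerivAt (w x) (w' x t) t) (ω : EuclideanSpace ℝ ι) :
    HasFDerivAt (fun ω : EuclideanSpace ℝ ι => ∑ x ∈ Y, w x (ω x + ψ x))
      (∑ x ∈ Y, (w' x (ω x + ψ x)) • (EuclideanSpace.proj x : EuclideanSpace ℝ ι →L[ℝ] ℝ)) ω := by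
  refine HasFDerivAt.fun_sum fun x _ => ?_
  have hlin : HasFDerivAt (fun ω : EuclideanSpace ℝ ι => ω x + ψ x) (EuclideanSpace.proj x : EuclideanSpace ℝ ι →L[ℝ] ℝ) ω :=
    ((EuclideanSpace.proj x : EuclideanSpace ℝ ι →L[ℝ] ℝ).hasFDerivAt).add_const (ψ x)
  exact (hw' x (ω x + ψ x)).comp_hasFDerivAt ω hlin

omit [DecidableEq ι] in
/-- `D_ω G = e^{−V}•(F′(u_z)•proj_z) + F(u_z)•(e^{−V}•(−D_ωV))`. [folklore] -/
theorem hasFDerivAt_G (hw' : ∀ x t, HasDerivAt (w x) (w' x t) t) (hF' : ∀ t, HasDerivAt F (F' t) t) (ω : EuclideanSpace ℝ ι) :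
    HasFDerivAt (fun ω : EuclideanSpace ℝ ι => exp (-(∑ x ∈ Y, w x (ω x + ψ x))) * F (ω z + ψ z))
      (exp (-(∑ x ∈ Y, w x (ω x + ψ x))) • ((F' (ω z + ψ z)) • (EuclideanSpace.proj z : EuclideanSpace ℝ ι →L[ℝ] ℝ)) +
        (F (ω z + ψ z)) • (exp (-(∑ x ∈ Y, w x (ω x + ψ x))) •
          (-(∑ x ∈ Y, (w' x (ω x + ψ x)) • (EuclideanSpace.proj x : EuclideanSpace ℝ ι →L[ℝ] ℝ))))) ω := by
  have hE : HasFDerivAt (fun ω : EuclideanSpace ℝ ι => exp (-(∑ x ∈ Y, w x (ω x + ψ x))))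
      (exp (-(∑ x ∈ Y, w x (ω x + ψ x))) • (-(∑ x ∈ Y, (w' x (ω x + ψ x)) • (EuclideanSpace.proj x : EuclideanSpace ℝ ι →L[ℝ] ℝ)))) ω :=
    (hasFDerivAt_V Y ψ hw' ω).neg.exp
  have hlin : HasFDerivAt (fun ω : EuclideanSpace ℝ ι => ω z + ψ z) (EuclideanSpace.proj z : EuclideanSpace ℝ ι →L[ℝ] ℝ) ω :=
    ((EuclideanSpace.proj z : EuclideanSpace ℝ ι →L[ℝ] ℝ).hasFDerivAt).add_const (ψ z)
  have hF : HasFDerivAt (fun ω : EuclideanSpace ℝ ι => F (ω z + ψ z))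
      ((F' (ω z + ψ z)) • (EuclideanSpace.proj z : EuclideanSpace ℝ ι →L[ℝ] ℝ)) ω :=
    (hF' (ω z + ψ z)).comp_hasFDerivAt ω hlin
  exact hE.mul hF

/-- **The derivative of `G` in the direction `e_b`**: `DG(ω)e_b = e^{−V}(F′(u_z)·1_{z=b} − F(u_z)·1_{b∈Y}w′_b(u_b))`. [folklore] -/
theorem fderiv_G_single (hw' : ∀ x t, HasDerivAt (w x) (w' x t) t) (hF' : ∀ t, HasDerivAt F (F' t) t) (ω : EuclideanSpace ℝ ι) (b : ι) :
    fderiv ℝ (fun ω : EuclideanSpace ℝ ι => exp (-(∑ x ∈ Y, w x (ω x + ψ x))) * F (ω z + ψ z)) ω (EuclideanSpace.single b (1 : ℝ)) =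
      exp (-(∑ x ∈ Y, w x (ω x + ψ x))) * ((if z = b then F' (ω z + ψ z) else 0) -
        F (ω z + ψ z) * (if b ∈ Y then w' b (ω b + ψ b) else 0)) := by
  rw [(hasFDerivAt_G Y ψ z hw' hF' ω).fderiv]
  have hproj : ∀ x : ι, (EuclideanSpace.proj x : EuclideanSpace ℝ ι →L[ℝ] ℝ) (EuclideanSpace.single b (1 : ℝ)) =
      if x = b then 1 else 0 := fun x => by
    rw [show (EuclideanSpace.proj x : EuclideanSpace ℝ ι →L[ℝ] ℝ) (EuclideanSpace.single b (1 : ℝ)) =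
      (EuclideanSpace.single b (1 : ℝ)) x from rfl]
    simp only [EuclideanSpace.single, PiLp.single_apply]
  simp only [_root_.add_apply, _root_.smul_apply, _root_.neg_apply, _root_.sum_apply, smul_eq_mul, hproj, mul_ite, mul_one,
    mul_zero]
  rw [Finset.sum_ite_eq' Y b]
  split_ifs <;> ring

omit [DecidableEq ι] in
/-- `G` is `C¹` when the remainders and the observable are. [folklore] -/
theorem contDiff_G (hwC : ∀ x, ContDiff ℝ 1 (w x)) (hFC : ContDiff ℝ 1 F) :
    ContDiff ℝ 1 (fun ω : EuclideanSpace ℝ ι => exp (-(∑ x ∈ Y, w x (ω x + ψ x))) * F (ω z + ψ z)) := by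
  have hsite : ∀ x : ι, ContDiff ℝ 1 (fun ω : EuclideanSpace ℝ ι => ω x + ψ x) := fun x =>
    ((EuclideanSpace.proj x : EuclideanSpace ℝ ι →L[ℝ] ℝ).contDiff).add contDiff_const
  have hV : ContDiff ℝ 1 (fun ω : EuclideanSpace ℝ ι => ∑ x ∈ Y, w x (ω x + ψ x)) :=
    ContDiff.sum fun x _ => (hwC x).comp (hsite x)
  exact (Real.contDiff_exp.comp hV.neg).mul (hFC.comp (hsite z))

/-! ## §3. Growth of `G` and `DG` -/

omit [DecidableEq ι] in
/-- `0 ≤ w`, `|F(t)| ≤ c(1+|t|)^m` ⟹ `|G(ω)| ≤ c(1+|ψ_z|)^m(1+‖ω‖)^m`. [folklore] -/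
theorem abs_G_le (hw0 : ∀ x t, 0 ≤ w x t) {c : ℝ} {m : ℕ} (hc : 0 ≤ c) (hFg : ∀ t, |F t| ≤ c * (1 + |t|) ^ m)
    (ω : EuclideanSpace ℝ ι) :
    |exp (-(∑ x ∈ Y, w x (ω x + ψ x))) * F (ω z + ψ z)| ≤ c * (1 + |ψ z|) ^ m * (1 + ‖ω‖) ^ m := by
  have hE1 : exp (-(∑ x ∈ Y, w x (ω x + ψ x))) ≤ 1 :=
    exp_le_one_iff.2 (neg_nonpos.2 (sum_nonneg fun x _ => hw0 x _))
  have hsite := one_add_abs_site_le ω (ψ z) z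
  rw [abs_mul, abs_of_pos (exp_pos _)]
  calc exp (-(∑ x ∈ Y, w x (ω x + ψ x))) * |F (ω z + ψ z)| ≤ 1 * (c * (1 + |ω z + ψ z|) ^ m) :=
        mul_le_mul hE1 (hFg _) (abs_nonneg _) zero_le_one
    _ ≤ c * ((1 + |ψ z|) * (1 + ‖ω‖)) ^ m := by
        rw [one_mul]
        exact mul_le_mul_of_nonneg_left (pow_le_pow_left₀ (by positivity) hsite m) hc
    _ = c * (1 + |ψ z|) ^ m * (1 + ‖ω‖) ^ m := by rw [mul_pow]; ring

omit [DecidableEq ι] in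
/-- `0 ≤ w`, `|w′_x(t)| ≤ κ₁|t|`, `|F|, |F′| ≤ c(1+|t|)^m` ⟹ `‖DG(ω)‖ ≤ c(1+|ψ_z|)^m(1 + κ₁(#Y + Σ|ψ|))(1+‖ω‖)^{m+1}`. [folklore] -/
theorem norm_fderiv_G_le (hw' : ∀ x t, HasDerivAt (w x) (w' x t) t) (hF' : ∀ t, HasDerivAt F (F' t) t) (hw0 : ∀ x t, 0 ≤ w x t)
    {κ₁ c : ℝ} {m : ℕ} (hκ₁ : 0 ≤ κ₁) (hc : 0 ≤ c) (hw'b : ∀ x t, |w' x t| ≤ κ₁ * |t|) (hFg : ∀ t, |F t| ≤ c * (1 + |t|) ^ m)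
    (hF'g : ∀ t, |F' t| ≤ c * (1 + |t|) ^ m) (ω : EuclideanSpace ℝ ι) :
    ‖fderiv ℝ (fun ω : EuclideanSpace ℝ ι => exp (-(∑ x ∈ Y, w x (ω x + ψ x))) * F (ω z + ψ z)) ω‖ ≤
      c * (1 + |ψ z|) ^ m * (1 + κ₁ * ((Y.card : ℝ) + ∑ x ∈ Y, |ψ x|)) * (1 + ‖ω‖) ^ (m + 1) := by
  have hE1 : exp (-(∑ x ∈ Y, w x (ω x + ψ x))) ≤ 1 :=
    exp_le_one_iff.2 (neg_nonpos.2 (sum_nonneg fun x _ => hw0 x _))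
  have hE0 : 0 < exp (-(∑ x ∈ Y, w x (ω x + ψ x))) := exp_pos _
  have hsite := one_add_abs_site_le ω (ψ z) z
  have hP : (1 + |ω z + ψ z|) ^ m ≤ (1 + |ψ z|) ^ m * (1 + ‖ω‖) ^ m := by
    rw [← mul_pow]; exact pow_le_pow_left₀ (by positivity) hsite m
  have hS := sum_abs_site_le Y ω ψ
  have hB0 : 0 ≤ c * (1 + |ψ z|) ^ m * (1 + κ₁ * ((Y.card : ℝ) + ∑ x ∈ Y, |ψ x|)) * (1 + ‖ω‖) ^ (m + 1) := by positivity
  refine ContinuousLinearMap.opNorm_le_bound _ hB0 fun v => ?_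
  rw [(hasFDerivAt_G Y ψ z hw' hF' ω).fderiv]
  have hpv : ∀ x : ι, (EuclideanSpace.proj x : EuclideanSpace ℝ ι →L[ℝ] ℝ) v = v x := fun x => rfl
  simp only [_root_.add_apply, _root_.smul_apply, _root_.neg_apply, _root_.sum_apply, smul_eq_mul, hpv, Real.norm_eq_abs]
  -- the two pieces
  have hvz : |v z| ≤ ‖v‖ := abs_apply_le_norm v z
  have hD : |∑ x ∈ Y, w' x (ω x + ψ x) * v x| ≤ κ₁ * (((Y.card : ℝ) + ∑ x ∈ Y, |ψ x|) * (1 + ‖ω‖)) * ‖v‖ := by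
    refine (abs_sum_le_sum_abs _ _).trans ?_
    have hpt : ∀ x ∈ Y, |w' x (ω x + ψ x) * v x| ≤ κ₁ * |ω x + ψ x| * ‖v‖ := fun x _ => by
      rw [abs_mul]
      exact mul_le_mul (hw'b x _) (abs_apply_le_norm v x) (abs_nonneg _) (by positivity)
    refine (sum_le_sum hpt).trans ?_
    rw [← sum_mul, ← mul_sum]
    exact mul_le_mul_of_nonneg_right (mul_le_mul_of_nonneg_left hS hκ₁) (norm_nonneg _)
  have h1 : |exp (-(∑ x ∈ Y, w x (ω x + ψ x))) * (F' (ω z + ψ z) * v z)| ≤ c * (1 + |ψ z|) ^ m * (1 + ‖ω‖) ^ m * ‖v‖ := by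
    rw [abs_mul, abs_of_pos hE0, abs_mul]
    calc exp (-(∑ x ∈ Y, w x (ω x + ψ x))) * (|F' (ω z + ψ z)| * |v z|) ≤ 1 * (c * (1 + |ω z + ψ z|) ^ m * ‖v‖) :=
          mul_le_mul hE1 (mul_le_mul (hF'g _) hvz (abs_nonneg _) (by positivity)) (by positivity) zero_le_one
      _ ≤ c * ((1 + |ψ z|) ^ m * (1 + ‖ω‖) ^ m) * ‖v‖ := by
          rw [one_mul]
          exact mul_le_mul_of_nonneg_right (mul_le_mul_of_nonneg_left hP hc) (norm_nonneg _)
      _ = _ := by ring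
  have h2 : |F (ω z + ψ z) * (exp (-(∑ x ∈ Y, w x (ω x + ψ x))) * -(∑ x ∈ Y, w' x (ω x + ψ x) * v x))| ≤
      c * (1 + |ψ z|) ^ m * (1 + ‖ω‖) ^ m * (κ₁ * (((Y.card : ℝ) + ∑ x ∈ Y, |ψ x|) * (1 + ‖ω‖)) * ‖v‖) := by
    rw [abs_mul, abs_mul, abs_neg, abs_of_pos hE0]
    calc |F (ω z + ψ z)| * (exp (-(∑ x ∈ Y, w x (ω x + ψ x))) * |∑ x ∈ Y, w' x (ω x + ψ x) * v x|)
        ≤ (c * (1 + |ω z + ψ z|) ^ m) * (1 * (κ₁ * (((Y.card : ℝ) + ∑ x ∈ Y, |ψ x|) * (1 + ‖ω‖)) * ‖v‖)) :=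
          mul_le_mul (hFg _) (mul_le_mul hE1 hD (abs_nonneg _) zero_le_one) (by positivity) (by positivity)
      _ ≤ (c * ((1 + |ψ z|) ^ m * (1 + ‖ω‖) ^ m)) * (1 * (κ₁ * (((Y.card : ℝ) + ∑ x ∈ Y, |ψ x|) * (1 + ‖ω‖)) * ‖v‖)) :=
          mul_le_mul_of_nonneg_right (mul_le_mul_of_nonneg_left hP hc) (by positivity)
      _ = _ := by ring
  have h3 := abs_add_le (exp (-(∑ x ∈ Y, w x (ω x + ψ x))) * (F' (ω z + ψ z) * v z))
    (F (ω z + ψ z) * (exp (-(∑ x ∈ Y, w x (ω x + ψ x))) * -(∑ x ∈ Y, w' x (ω x + ψ x) * v x)))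
  -- assembly with small atoms
  set P : ℝ := (1 + |ψ z|) ^ m with hPdef
  set Bs : ℝ := (Y.card : ℝ) + ∑ x ∈ Y, |ψ x| with hBs
  set nω : ℝ := ‖ω‖ with hnω
  have hn0 : 0 ≤ nω := norm_nonneg ω
  have hBs0 : 0 ≤ Bs := by rw [hBs]; positivity
  have hA0 : 0 ≤ c * P * (1 + nω) ^ m * ‖v‖ := by positivity
  have hX : c * P * (1 + nω) ^ m * ‖v‖ * (1 + κ₁ * (Bs * (1 + nω))) ≤
      c * P * (1 + nω) ^ m * ‖v‖ * ((1 + nω) * (1 + κ₁ * Bs)) := by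
    refine mul_le_mul_of_nonneg_left ?_ hA0
    nlinarith [mul_nonneg hκ₁ hBs0]
  calc _ ≤ _ := h3
    _ ≤ c * P * (1 + nω) ^ m * ‖v‖ + c * P * (1 + nω) ^ m * (κ₁ * (Bs * (1 + nω)) * ‖v‖) := add_le_add h1 h2
    _ = c * P * (1 + nω) ^ m * ‖v‖ * (1 + κ₁ * (Bs * (1 + nω))) := by ring
    _ ≤ c * P * (1 + nω) ^ m * ‖v‖ * ((1 + nω) * (1 + κ₁ * Bs)) := hX
    _ = c * P * (1 + κ₁ * Bs) * (1 + nω) ^ (m + 1) * ‖v‖ := by ring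

end Calculus

/-! ## §4. THE END: the tilted Stein identity -/

section Main

variable {Γ : Matrix ι ι ℝ} (Y : Finset ι) {w w' : ι → ℝ → ℝ} {F F' : ℝ → ℝ} {κ₁ c : ℝ} {m : ℕ} (ψ : ι → ℝ) (y z : ι)

/-- **THE TILTED STEIN IDENTITY.**  `Γ ⪰ 0`; `C¹` remainders `w_x` (`ContDiff ℝ 1`, derivative `w′_x` with `|w′_x(t)| ≤ κ₁|t|`, measurable)
that are NONNEGATIVE; a `C¹` observable `F` (derivative `F′`, measurable) with `|F|, |F′| ≤ c(1+|t|)^m` ⟹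
`∫ ω_y·e^{−V}F(u_z) dN(0,Γ) = Γ_{yz}·∫ e^{−V}F′(u_z) dN(0,Γ) − Σ_{x∈Y}Γ_{yx}·∫ e^{−V}F(u_z)w′_x(u_x) dN(0,Γ)`. [folklore] -/
theorem tilted_stein (hΓ : Γ.PosSemidef) (hwC : ∀ x, ContDiff ℝ 1 (w x)) (hw' : ∀ x t, HasDerivAt (w x) (w' x t) t)
    (hw'm : ∀ x, Measurable (w' x)) (hw0 : ∀ x t, 0 ≤ w x t) (hκ₁ : 0 ≤ κ₁) (hw'b : ∀ x t, |w' x t| ≤ κ₁ * |t|)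
    (hFC : ContDiff ℝ 1 F) (hF' : ∀ t, HasDerivAt F (F' t) t) (hF'm : Measurable F') (hc : 0 ≤ c)
    (hFg : ∀ t, |F t| ≤ c * (1 + |t|) ^ m) (hF'g : ∀ t, |F' t| ≤ c * (1 + |t|) ^ m) :
    ∫ ω : EuclideanSpace ℝ ι, ω y * (exp (-(∑ x ∈ Y, w x (ω x + ψ x))) * F (ω z + ψ z)) ∂(multivariateGaussian 0 Γ) =
      Γ y z * ∫ ω : EuclideanSpace ℝ ι, exp (-(∑ x ∈ Y, w x (ω x + ψ x))) * F' (ω z + ψ z) ∂(multivariateGaussian 0 Γ) -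
        ∑ x ∈ Y, Γ y x * ∫ ω : EuclideanSpace ℝ ι, exp (-(∑ x' ∈ Y, w x' (ω x' + ψ x'))) * (F (ω z + ψ z) * w' x (ω x + ψ x))
          ∂(multivariateGaussian 0 Γ) := by
  -- growth letters with a common `K, N`
  set K : ℝ := c * (1 + |ψ z|) ^ m * (1 + κ₁ * ((Y.card : ℝ) + ∑ x ∈ Y, |ψ x|)) with hK
  have hK1 : c * (1 + |ψ z|) ^ m ≤ K := by
    rw [hK]
    exact le_mul_of_one_le_right (by positivity) (by nlinarith [sum_nonneg (fun x (_ : x ∈ Y) => abs_nonneg (ψ x)), hκ₁])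
  have hGK : ∀ ω : EuclideanSpace ℝ ι, |exp (-(∑ x ∈ Y, w x (ω x + ψ x))) * F (ω z + ψ z)| ≤ K * (1 + ‖ω‖) ^ (m + 1) := fun ω => by
    refine (abs_G_le Y ψ z hw0 hc hFg ω).trans ?_
    have hω1 : 1 ≤ 1 + ‖ω‖ := by linarith [norm_nonneg ω]
    have hpow : (1 + ‖ω‖) ^ m ≤ (1 + ‖ω‖) ^ (m + 1) := by
      rw [pow_succ]; exact le_mul_of_one_le_right (by positivity) hω1
    exact mul_le_mul hK1 hpow (by positivity) (by positivity)
  have hDK : ∀ ω : EuclideanSpace ℝ ι,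
      ‖fderiv ℝ (fun ω : EuclideanSpace ℝ ι => exp (-(∑ x ∈ Y, w x (ω x + ψ x))) * F (ω z + ψ z)) ω‖ ≤ K * (1 + ‖ω‖) ^ (m + 1) :=
    fun ω => norm_fderiv_G_le Y ψ z hw' hF' hw0 hκ₁ hc hw'b hFg hF'g ω
  -- the tree's multivariate Stein identity
  have key := integral_eval_mul_eq_sum hΓ y (contDiff_G Y ψ z hwC hFC) hGK hDK
  rw [key]
  simp_rw [fderiv_G_single Y ψ z hw' hF']
  -- measurability and integrability of the two pieces
  have hwm : ∀ x, Measurable (w x) := fun x => (hwC x).continuous.measurable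
  have hFm : Measurable F := hFC.continuous.measurable
  have hsite : ∀ x, Measurable fun ω : EuclideanSpace ℝ ι => ω x + ψ x := fun x =>
    (by fun_prop : Measurable fun ω : EuclideanSpace ℝ ι => ω x).add_const _
  have hEm : Measurable fun ω : EuclideanSpace ℝ ι => exp (-(∑ x ∈ Y, w x (ω x + ψ x))) :=
    measurable_exp.comp (Finset.measurable_sum _ fun x _ => (hwm x).comp (hsite x)).neg
  have hE1 : ∀ ω : EuclideanSpace ℝ ι, exp (-(∑ x ∈ Y, w x (ω x + ψ x))) ≤ 1 := fun ω =>
    exp_le_one_iff.2 (neg_nonpos.2 (sum_nonneg fun x _ => hw0 x _))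
  have hIA : Integrable (fun ω : EuclideanSpace ℝ ι => exp (-(∑ x ∈ Y, w x (ω x + ψ x))) * F' (ω z + ψ z)) (multivariateGaussian 0 Γ) := by
    have hb : ∀ ω : EuclideanSpace ℝ ι, ‖exp (-(∑ x ∈ Y, w x (ω x + ψ x))) * F' (ω z + ψ z)‖ ≤
        c * (1 + |ψ z|) ^ m * (1 + ‖ω‖) ^ m := fun ω => by
      rw [Real.norm_eq_abs, abs_mul, abs_of_pos (exp_pos _)]
      calc exp (-(∑ x ∈ Y, w x (ω x + ψ x))) * |F' (ω z + ψ z)| ≤ 1 * (c * (1 + |ω z + ψ z|) ^ m) :=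
            mul_le_mul (hE1 ω) (hF'g _) (abs_nonneg _) zero_le_one
        _ ≤ c * ((1 + |ψ z|) * (1 + ‖ω‖)) ^ m := by
            rw [one_mul]; exact mul_le_mul_of_nonneg_left (pow_le_pow_left₀ (by positivity) (one_add_abs_site_le ω (ψ z) z) m) hc
        _ = c * (1 + |ψ z|) ^ m * (1 + ‖ω‖) ^ m := by rw [mul_pow]; ring
    exact integrable_of_poly_growth Γ ((hEm.mul (hF'm.comp (hsite z))).aestronglyMeasurable) hb
  have hIB : ∀ x ∈ Y, Integrable (fun ω : EuclideanSpace ℝ ι => exp (-(∑ x' ∈ Y, w x' (ω x' + ψ x'))) *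
      (F (ω z + ψ z) * w' x (ω x + ψ x))) (multivariateGaussian 0 Γ) := fun x _ => by
    refine integrable_of_poly_growth Γ ((hEm.mul ((hFm.comp (hsite z)).mul ((hw'm x).comp (hsite x)))).aestronglyMeasurable)
      (fun ω => (?_ : _ ≤ c * (1 + |ψ z|) ^ m * (κ₁ * (1 + |ψ x|)) * (1 + ‖ω‖) ^ (m + 1)))
    rw [Real.norm_eq_abs, abs_mul, abs_of_pos (exp_pos _), abs_mul]
    have h1 : |F (ω z + ψ z)| ≤ c * (1 + |ψ z|) ^ m * (1 + ‖ω‖) ^ m := by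
      calc |F (ω z + ψ z)| ≤ c * (1 + |ω z + ψ z|) ^ m := hFg _
        _ ≤ c * ((1 + |ψ z|) * (1 + ‖ω‖)) ^ m :=
            mul_le_mul_of_nonneg_left (pow_le_pow_left₀ (by positivity) (one_add_abs_site_le ω (ψ z) z) m) hc
        _ = _ := by rw [mul_pow]; ring
    have h2 : |w' x (ω x + ψ x)| ≤ κ₁ * (1 + |ψ x|) * (1 + ‖ω‖) := by
      refine (hw'b x _).trans ?_
      have := one_add_abs_site_le ω (ψ x) x
      nlinarith [abs_nonneg (ω x + ψ x)]
    calc exp (-(∑ x' ∈ Y, w x' (ω x' + ψ x'))) * (|F (ω z + ψ z)| * |w' x (ω x + ψ x)|)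
        ≤ 1 * ((c * (1 + |ψ z|) ^ m * (1 + ‖ω‖) ^ m) * (κ₁ * (1 + |ψ x|) * (1 + ‖ω‖))) :=
          mul_le_mul (hE1 ω) (mul_le_mul h1 h2 (abs_nonneg _) (by positivity)) (by positivity) zero_le_one
      _ = c * (1 + |ψ z|) ^ m * (κ₁ * (1 + |ψ x|)) * (1 + ‖ω‖) ^ (m + 1) := by rw [pow_succ]; ring
  -- split each integral and collapse the Kronecker sums
  have hsplit : ∀ b : ι, ∫ ω : EuclideanSpace ℝ ι, exp (-(∑ x ∈ Y, w x (ω x + ψ x))) *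
      ((if z = b then F' (ω z + ψ z) else 0) - F (ω z + ψ z) * (if b ∈ Y then w' b (ω b + ψ b) else 0)) ∂(multivariateGaussian 0 Γ) =
      (if z = b then ∫ ω : EuclideanSpace ℝ ι, exp (-(∑ x ∈ Y, w x (ω x + ψ x))) * F' (ω z + ψ z) ∂(multivariateGaussian 0 Γ) else 0) -
        (if b ∈ Y then ∫ ω : EuclideanSpace ℝ ι, exp (-(∑ x' ∈ Y, w x' (ω x' + ψ x'))) * (F (ω z + ψ z) * w' b (ω b + ψ b)) ∂(multivariateGaussian 0 Γ)
          else 0) := fun b => by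
    by_cases hzb : z = b
    · by_cases hbY : b ∈ Y
      · simp only [if_pos hzb, if_pos hbY]
        rw [← integral_sub hIA (hIB b hbY)]
        exact integral_congr_ae (ae_of_all _ fun ω => by ring)
      · simp only [if_pos hzb, if_neg hbY, mul_zero, sub_zero]
    · by_cases hbY : b ∈ Y
      · simp only [if_neg hzb, if_pos hbY, zero_sub, mul_neg, integral_neg]
      · simp only [if_neg hzb, if_neg hbY, mul_zero, sub_zero, integral_zero]
  simp_rw [hsplit, mul_sub, sum_sub_distrib, mul_ite, mul_zero]
  rw [Finset.sum_ite_eq Finset.univ z, if_pos (mem_univ z), Finset.sum_ite_mem, univ_inter]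

/-- **THE TILTED MEAN OF A LINEAR OBSERVABLE** (`F ≡ 1`): `∫ ω_y e^{−V} dN(0,Γ) = −Σ_{x∈Y}Γ_{yx}∫ e^{−V}w′_x(u_x) dN(0,Γ)` — so
`E_ν[ω_y] = −Σ_xΓ_{yx}E_ν[w′_x]` is `O(γε)` by (314)'s gradient letter. [folklore] -/
theorem tilted_stein_mean (hΓ : Γ.PosSemidef) (hwC : ∀ x, ContDiff ℝ 1 (w x)) (hw' : ∀ x t, HasDerivAt (w x) (w' x t) t)
    (hw'm : ∀ x, Measurable (w' x)) (hw0 : ∀ x t, 0 ≤ w x t) (hκ₁ : 0 ≤ κ₁) (hw'b : ∀ x t, |w' x t| ≤ κ₁ * |t|) :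
    ∫ ω : EuclideanSpace ℝ ι, ω y * exp (-(∑ x ∈ Y, w x (ω x + ψ x))) ∂(multivariateGaussian 0 Γ) =
      -∑ x ∈ Y, Γ y x * ∫ ω : EuclideanSpace ℝ ι, exp (-(∑ x' ∈ Y, w x' (ω x' + ψ x'))) * w' x (ω x + ψ x)
        ∂(multivariateGaussian 0 Γ) := by
  have h := tilted_stein Y ψ y y hΓ hwC hw' hw'm hw0 hκ₁ hw'b (F := fun _ => (1 : ℝ)) (F' := fun _ => (0 : ℝ)) (c := 1) (m := 0)
    contDiff_const (fun t => hasDerivAt_const t (1 : ℝ)) measurable_const zero_le_one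
    (fun t => by simp) (fun t => by simp)
  have e1 : ∫ ω : EuclideanSpace ℝ ι, ω y * (exp (-(∑ x ∈ Y, w x (ω x + ψ x))) * 1) ∂(multivariateGaussian 0 Γ) =
      ∫ ω : EuclideanSpace ℝ ι, ω y * exp (-(∑ x ∈ Y, w x (ω x + ψ x))) ∂(multivariateGaussian 0 Γ) :=
    integral_congr_ae (ae_of_all _ fun ω => by ring)
  have e2 : ∫ ω : EuclideanSpace ℝ ι, exp (-(∑ x ∈ Y, w x (ω x + ψ x))) * (0 : ℝ) ∂(multivariateGaussian 0 Γ) = 0 := by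
    simp
  have e3 : ∀ x, ∫ ω : EuclideanSpace ℝ ι, exp (-(∑ x' ∈ Y, w x' (ω x' + ψ x'))) * (1 * w' x (ω x + ψ x)) ∂(multivariateGaussian 0 Γ) =
      ∫ ω : EuclideanSpace ℝ ι, exp (-(∑ x' ∈ Y, w x' (ω x' + ψ x'))) * w' x (ω x + ψ x) ∂(multivariateGaussian 0 Γ) := fun x =>
    integral_congr_ae (ae_of_all _ fun ω => by ring)
  rw [e1, e2, mul_zero, zero_sub] at h
  simp_rw [e3] at h
  exact h

end Main

/-! ## §5. Toy -/

/-- Toy (§1): a coordinate is bounded by the Euclidean norm. -/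
example (ω : EuclideanSpace ℝ (Fin 2)) : |ω 0| ≤ ‖ω‖ := abs_apply_le_norm ω 0

end Summit.QuantumFields.BalabanUV.T4Continuum.NE7b.SupTiltedSteinIdentity
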